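import Mathlib
import Summits.ValiantsHypothesis.ValiantsHypothesis.Theorems.KPlusLogSqLawResolvedAlternatingToward

/-!
# Route «KPlusLogSqLaw», crux `WeakLifting` (stmt-ValiantsHypothesis-19561) — α row, RESOLVED limit:
# the COMPONENT EXCHANGE LEMMA for parametric path matchings (any edge word; g17)

HONEST FRAMING.  Helper lemmas (`--supports stmt-ValiantsHypothesis-19561 --as helper`), seat pub-symmetroid-conjb-2 (g17), cell `pub-symmetroid`,
2026-08-28.  Elementary exchange argument; nothing here is a root count, and nothing bears on `WeakLifting` / `TropicalB` in their windows, on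
Conjecture B (`KPlusLogSqLaw`), on `MatrixDescartes` or on VP ≠ VNP.

CONTEXT (paper: HOME/pub-symmetroid-conjb-2/g17/theory/THEORY-NOTE-g17.md §4.6–§4.7; companion file `KPlusLogSqLawResolvedAlternatingToward.lean`).
Edges `0, …, N − 1` of a path, matchings = finsets `μ ⊆ range N` of pairwise non-consecutive edges, weight `Σ_{k∈μ} a_k + t Σ_{k∈μ} λ_k`.  For two
matchings `μ, μ'` and a part `P` of their symmetric difference that is CLOSED UNDER ADJACENCY inside the symmetric difference (a union of its runs):
(1) the swaps `(μ \ P) ∪ (μ' ∩ P)` and `(μ' \ P) ∪ (μ ∩ P)` are matchings (`swap_nonconsec`) and their weights add up to `W μ + W μ'` (`sum_swap`);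
(2) if `μ` and `μ'` are both optimal at `t₂`, each swap is optimal at `t₂` (`swap_optimal`); (3) if moreover `μ` is optimal at some `t₁ < t₂`, the part
`P` has NONNEGATIVE SLOPE GAIN `Σ_{μ'∩P} λ ≥ Σ_{μ∩P} λ` (`swap_gain_nonneg`; applied to the complementary part it also bounds the gain by the total gain) — the general tool of which the alternating-word toward lemma is the case
«P = the away flips»; for the two-speed resolved Descartes row (note §4, conjecture D_{Λ2}) it says that every run of a hull exchange pays for its own
«away» flips.  [this seat; elementary]
-/

-- `Summit.ValiantsHypothesis.ValiantsHypothesis.…` repeats a component by the D-0017 layout (single-conjunct summit); the name is mandated.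
set_option linter.dupNamespace false

namespace Summit.ValiantsHypothesis.ValiantsHypothesis.Theorems.KPlusLogSqLaw.ResolvedExchange

open Finset
open Summit.ValiantsHypothesis.ValiantsHypothesis.Theorems.KPlusLogSqLaw.ResolvedAlternating (sum_split sum_swap disjoint_sdiff_inter')

/-- the slope of the swap: `Σ_{(μ \ P) ∪ (μ' ∩ P)} λ = Σ_μ λ − Σ_{μ∩P} λ + Σ_{μ'∩P} λ`. -/
theorem sum_swap_eq (f : ℕ → ℝ) (μ μ' P : Finset ℕ) :
    ∑ k ∈ μ \ P ∪ μ' ∩ P, f k = ∑ k ∈ μ, f k - ∑ k ∈ μ ∩ P, f k + ∑ k ∈ μ' ∩ P, f k := by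
  rw [sum_union (disjoint_sdiff_inter' μ μ' P), sum_split f μ P]
  ring

/-- (1) THE SWAP IS A MATCHING.  `μ, μ'` pairwise non-consecutive; `P` closed under adjacency inside the symmetric difference (if `i ∈ P` and
`i + 1` lies in exactly one of `μ, μ'` then `i + 1 ∈ P`, and symmetrically downwards).  Then
`(μ \ P) ∪ (μ' ∩ P)` is pairwise non-consecutive. -/
theorem swap_nonconsec (μ μ' P : Finset ℕ)
    (hμm : ∀ i ∈ μ, i + 1 ∉ μ) (hμ'm : ∀ i ∈ μ', i + 1 ∉ μ')
    (hup : ∀ i ∈ P, (i + 1 ∈ μ ∨ i + 1 ∈ μ') → ¬ (i + 1 ∈ μ ∧ i + 1 ∈ μ') → i + 1 ∈ P)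
    (hdown : ∀ i, i + 1 ∈ P → (i ∈ μ ∨ i ∈ μ') → ¬ (i ∈ μ ∧ i ∈ μ') → i ∈ P) :
    ∀ i ∈ μ \ P ∪ μ' ∩ P, i + 1 ∉ μ \ P ∪ μ' ∩ P := by
  intro i hi hi1
  rcases mem_union.1 hi with h | h <;> rcases mem_union.1 hi1 with h' | h'
  · exact hμm i (mem_sdiff.1 h).1 (mem_sdiff.1 h').1
  · obtain ⟨hiμ, hiP⟩ := mem_sdiff.1 h
    obtain ⟨hi1μ', hi1P⟩ := mem_inter.1 h'
    by_cases hiμ' : i ∈ μ'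
    · exact hμ'm i hiμ' hi1μ'
    · exact hiP (hdown i hi1P (Or.inl hiμ) (fun hh => hiμ' hh.2))
  · obtain ⟨hiμ', hiP⟩ := mem_inter.1 h
    obtain ⟨hi1μ, hi1P⟩ := mem_sdiff.1 h'
    by_cases hi1μ' : i + 1 ∈ μ'
    · exact hμ'm i hiμ' hi1μ'
    · exact hi1P (hup i hiP (Or.inl hi1μ) (fun hh => hi1μ' hh.2))
  · exact hμ'm i (mem_inter.1 h).1 (mem_inter.1 h').1

/-- the swap stays inside `range N`. -/
theorem swap_subset_range (N : ℕ) (μ μ' P : Finset ℕ) (hμN : μ ⊆ range N) (hμ'N : μ' ⊆ range N) :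
    μ \ P ∪ μ' ∩ P ⊆ range N := by
  intro i hi
  rcases mem_union.1 hi with h | h
  · exact hμN (mem_sdiff.1 h).1
  · exact hμ'N (mem_inter.1 h).1

/-- (2) BOTH SWAPS ARE OPTIMAL when `μ` and `μ'` are both optimal at `t`. -/
theorem swap_optimal (N : ℕ) (a lam : ℕ → ℝ) (t : ℝ) (μ μ' P : Finset ℕ)
    (hμN : μ ⊆ range N) (hμm : ∀ i ∈ μ, i + 1 ∉ μ) (hμ'N : μ' ⊆ range N) (hμ'm : ∀ i ∈ μ', i + 1 ∉ μ')
    (hup : ∀ i ∈ P, (i + 1 ∈ μ ∨ i + 1 ∈ μ') → ¬ (i + 1 ∈ μ ∧ i + 1 ∈ μ') → i + 1 ∈ P)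
    (hdown : ∀ i, i + 1 ∈ P → (i ∈ μ ∨ i ∈ μ') → ¬ (i ∈ μ ∧ i ∈ μ') → i ∈ P)
    (hopt : ∀ ν : Finset ℕ, ν ⊆ range N → (∀ i ∈ ν, i + 1 ∉ ν) →
      ∑ k ∈ ν, a k + t * ∑ k ∈ ν, lam k ≤ ∑ k ∈ μ, a k + t * ∑ k ∈ μ, lam k)
    (hopt' : ∀ ν : Finset ℕ, ν ⊆ range N → (∀ i ∈ ν, i + 1 ∉ ν) →
      ∑ k ∈ ν, a k + t * ∑ k ∈ ν, lam k ≤ ∑ k ∈ μ', a k + t * ∑ k ∈ μ', lam k) :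
    ∑ k ∈ μ \ P ∪ μ' ∩ P, a k + t * ∑ k ∈ μ \ P ∪ μ' ∩ P, lam k = ∑ k ∈ μ, a k + t * ∑ k ∈ μ, lam k := by
  have hν := hopt _ (swap_subset_range N μ μ' P hμN hμ'N) (swap_nonconsec μ μ' P hμm hμ'm hup hdown)
  have hup' : ∀ i ∈ P, (i + 1 ∈ μ' ∨ i + 1 ∈ μ) → ¬ (i + 1 ∈ μ' ∧ i + 1 ∈ μ) → i + 1 ∈ P :=
    fun i hi h1 h2 => hup i hi (h1.symm) (fun hh => h2 ⟨hh.2, hh.1⟩)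
  have hdown' : ∀ i, i + 1 ∈ P → (i ∈ μ' ∨ i ∈ μ) → ¬ (i ∈ μ' ∧ i ∈ μ) → i ∈ P :=
    fun i hi h1 h2 => hdown i hi (h1.symm) (fun hh => h2 ⟨hh.2, hh.1⟩)
  have hν' := hopt' _ (swap_subset_range N μ' μ P hμ'N hμN)
    (swap_nonconsec μ' μ P hμ'm hμm hup' hdown')
  have hsa := sum_swap a μ μ' P
  have hsl := sum_swap lam μ μ' P
  have h3 := congrArg (fun x => t * x) hsl
  simp only [mul_add] at h3
  linarith

/-- (3) NONNEGATIVE SLOPE GAIN OF EVERY ADJACENCY-CLOSED PART.  If in addition `μ` is optimal at some earlier time `t₁ < t₂`, then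
`Σ_{μ ∩ P} λ ≤ Σ_{μ' ∩ P} λ`: every run of the exchange pays for its own «away» flips. -/
theorem swap_gain_nonneg (N : ℕ) (a lam : ℕ → ℝ) (t₁ t₂ : ℝ) (ht : t₁ < t₂) (μ μ' P : Finset ℕ)
    (hμN : μ ⊆ range N) (hμm : ∀ i ∈ μ, i + 1 ∉ μ) (hμ'N : μ' ⊆ range N) (hμ'm : ∀ i ∈ μ', i + 1 ∉ μ')
    (hup : ∀ i ∈ P, (i + 1 ∈ μ ∨ i + 1 ∈ μ') → ¬ (i + 1 ∈ μ ∧ i + 1 ∈ μ') → i + 1 ∈ P)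
    (hdown : ∀ i, i + 1 ∈ P → (i ∈ μ ∨ i ∈ μ') → ¬ (i ∈ μ ∧ i ∈ μ') → i ∈ P)
    (hopt₁ : ∀ ν : Finset ℕ, ν ⊆ range N → (∀ i ∈ ν, i + 1 ∉ ν) →
      ∑ k ∈ ν, a k + t₁ * ∑ k ∈ ν, lam k ≤ ∑ k ∈ μ, a k + t₁ * ∑ k ∈ μ, lam k)
    (hopt₂ : ∀ ν : Finset ℕ, ν ⊆ range N → (∀ i ∈ ν, i + 1 ∉ ν) →
      ∑ k ∈ ν, a k + t₂ * ∑ k ∈ ν, lam k ≤ ∑ k ∈ μ, a k + t₂ * ∑ k ∈ μ, lam k)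
    (hopt₂' : ∀ ν : Finset ℕ, ν ⊆ range N → (∀ i ∈ ν, i + 1 ∉ ν) →
      ∑ k ∈ ν, a k + t₂ * ∑ k ∈ ν, lam k ≤ ∑ k ∈ μ', a k + t₂ * ∑ k ∈ μ', lam k) :
    ∑ k ∈ μ ∩ P, lam k ≤ ∑ k ∈ μ' ∩ P, lam k := by
  have hW₂ := swap_optimal N a lam t₂ μ μ' P hμN hμm hμ'N hμ'm hup hdown hopt₂ hopt₂'
  have hW₁ := hopt₁ _ (swap_subset_range N μ μ' P hμN hμ'N) (swap_nonconsec μ μ' P hμm hμ'm hup hdown)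
  have hsl := sum_swap_eq lam μ μ' P
  rw [hsl] at hW₂ hW₁
  by_contra hlt
  have hlt' : ∑ k ∈ μ' ∩ P, lam k < ∑ k ∈ μ ∩ P, lam k := lt_of_not_ge hlt
  nlinarith [hW₂, hW₁, hlt', ht]

end Summit.ValiantsHypothesis.ValiantsHypothesis.Theorems.KPlusLogSqLaw.ResolvedExchange
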